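/-
Copyright (c) 2026 the pub-hodgecm-mathlib formalisation cell (harness21).  Prover seat hodgecm-mathlib-F0P2-p07 (g0), strike line L1
`stub_firstTermThetaPairing` (LEAD F0P6-plan (g14) BATCH #64∕#68: «ramified `hmid` = F0P2-p07»): Track B «K2-LIT», hLiu418 = stmt-HodgeConjecture-24832, road `K2_Liu`,
socket #42S, organ S1 ROAD W: THE RAMIFIED DILATION ROW `hd₁` FOR ONE EXP-READING, FROM THE (C3) CHAIN.
-/
import Summits.HodgeConjecture.HodgeConjecture.Theorems.K2LiuNonsplitMiddleProfileRowOfReading      -- 📤 p863057: the non-split composition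
import Summits.HodgeConjecture.HodgeConjecture.Theorems.K2LiuLocalSWRamifiedLeviRowInvarianceCM    -- ★ p862778: `flip_mul_localCongr_dA_eq_of_levi_factorisation`
import HarnessLib

/-!
# Crux `HLiu418`, #42S organ S1, ROAD W: THE RAMIFIED DILATION ROW `F_Φ(w₁ · Ad_{d_a} x) = F_Φ(w₁ · x)` ON `P_Δ` FOR ONE LATTICE-PAIR EXP-READING

Cell `hodgecm-mathlib`, crux item hLiu418 = `stmt-HodgeConjecture-24832`; squad K2 ∕ K2Liu; LEAD F0P6-plan (g14); prover F0P2-p07 (g0).  THEOREMS ONLY (no `def`, no instance,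
no notation, no named-fact hypothesis, no `sorry`); lane `--supports stmt-HodgeConjecture-24832 --as helper`.

WHY.  ★ p862306 `…OfMpMoverMiddleRow` proves the ramified S1 face modulo ONE row `hmid` whose conclusion is, for every exp-reading `(Φ, P₃, κ)` of the mover
`m = frameMp_{PD} j̃(p₁,p₂)`, the dilation row `hd₁ : ∀ x ∈ P_Δ, F_Φ(w₁ · Ad_{d_a} x) = F_Φ(w₁ · x)`.  THIS FILE pays `hd₁` from the (M2a) chain: the non-split composition
📤 `exists_factorisation_of_expReading_nonsplit` gives the factorisation `F_Φ(w₁·(n(t)·m)) = K_c · G(t, m)` on `N_Δ · M_Δ` with `G` BY VALUE, whose ONLY `t`-dependence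
is the ball-triviality letter of `Ψ_{s_t}`, `s_t = −im_Q((𝕊·t)_{i₀i₀})`; `Ad(d_a)` fixes `m` and rescales `t ↦ a_v⁻¹•t` (★ p862778), `s_{a_v⁻¹•t} = a_v⁻¹·s_t`
(`im_gramS_mul_smul_apply`), and a `w₀`-UNIT rescaling does not change triviality on a ball (★ `forall_tracePhase_mul_eq_one_iff`, `|ι a|_{w₀} = 1` — the socket's
ramified letter `ha₁`); ★ p862778 §4 `flip_mul_localCongr_dA_eq_of_levi_factorisation` concludes.
* §1 `im_gramS_mul_smul_apply` — `im_Q((𝕊·(ι_v(r)•t))_{ij}) = r · im_Q((𝕊·t)_{ij})`;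
* §2 **`flip_mul_localCongr_dA_eq_of_expReading`** — binders = 📤 p863057's + the similitude letters `(a, Dsim, DA, b)` of ★ p862306 + `ha₁v : v_{w₀}(ι a) = 1` + `hτr`;
  conclusion `∀ x, IsSiegelDelta … x → F_Φ(w₁ · Ad_{d_a} x) = F_Φ(w₁ · x)`.
References: [Kudla1994] §3 Thm. 3.1; [KudlaSweet1997] §1; [HarrisKudlaSweet1996] §1 (1.11), (1.15); [MoeglinVignerasWaldspurger1987] Chap. 2 II.1 (`ψ ↦ ψ_a`), II.6.
HONEST LABEL.  Count-neutral helper; it retires nothing by itself: `HC_CM` is proved only modulo the 7 printed citations (2 remaining named inputs: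
hLiu418 = `stmt-HodgeConjecture-24832`, h413 = `stmt-HodgeConjecture-24833`) until rung 0 closes.  NOT here: the discharge of the chain letters (block data, `hEY hEW`
(C2c), `hprof`), the hmid-free face (next file).

## References
* [Kudla1994] S. S. Kudla, Israel J. Math. 87 (1994), §3 Thm. 3.1.
* [KudlaSweet1997] S. S. Kudla, W. J. Sweet, Israel J. Math. 98 (1997), §1.
* [HarrisKudlaSweet1996] M. Harris, S. Kudla, W. J. Sweet, J. Amer. Math. Soc. 9 (1996), §1 (1.11), (1.15).
* [MoeglinVignerasWaldspurger1987] C. Mœglin, M.-F. Vignéras, J.-L. Waldspurger, LNM 1291 (1987), Chap. 2 II.1, II.6.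
-/

set_option autoImplicit false
set_option linter.dupNamespace false -- the mandated namespace repeats `HodgeConjecture.HodgeConjecture`

noncomputable section

open scoped Matrix Kronecker ENNReal NNReal
open NumberField IsDedekindDomain MeasureTheory Matrix
open Literature.RepresentationTheory.HeisenbergGroup Literature.RepresentationTheory.HeisenbergGroup.SymplecticMatrix
open Literature.NumberTheory.Automorphic Literature.NumberTheory.Automorphic.UnitaryGroup Literature.NumberTheory.Weil1964
open Literature.NumberTheory.Automorphic.UnitaryGroup.QuadraticCoordinates
open Literature.NumberTheory.GaloisRepresentations Literature.NumberTheory.GaloisRepresentations.IsNonarchimedeanLocalField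
open Literature.RepresentationTheory.HarrisKudlaSweet1996
open Literature.NumberTheory.GelbartRogawski1991 Literature.NumberTheory.GelbartRogawski1991.GRConstruction
open Literature.NumberTheory.GelbartRogawski1991.AdaptedBlocks
open Literature.NumberTheory.GelbartRogawski1991.UnitaryDualPair
open Literature.NumberTheory.GelbartRogawski1991.UnitaryDualPair.LocalSplitting
open Literature.NumberTheory.GelbartRogawski1991.UnitaryDualPair.LocalSplitting.FrameTransport
open Literature.NumberTheory.GelbartRogawski1991.UnitaryDualPair.LocalSplitting.DoubledBlock
open Literature.NumberTheory.K2Lit.SiegelDoubled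
open Summit.HodgeConjecture.HodgeConjecture.Cruxes.HLiu418.K2LiuLocalSWSectionDefs
open Summit.HodgeConjecture.HodgeConjecture.Cruxes.HLiu418.K2LiuLocalSWTensorBlockTransport
open Summit.HodgeConjecture.HodgeConjecture.Cruxes.HLiu418.K2LiuA7ValueInstanceDefs
open Summit.HodgeConjecture.HodgeConjecture.Cruxes.HLiu418.K2LiuNonsplitMiddleProfileRowOfReading
open Summit.HodgeConjecture.HodgeConjecture.Cruxes.HLiu418.K2LiuNonsplitTracePhase
open Summit.HodgeConjecture.HodgeConjecture.Cruxes.HLiu418.K2LiuLocalSWRamifiedLeviRowInvarianceCM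

namespace Summit.HodgeConjecture.HodgeConjecture.Cruxes.HLiu418.K2LiuRamifiedMiddleRowOfReading

/-! ## §1 The unipotent phase scalar is `F_v`-linear in `t` -/

/-- **`im_Q((𝕊·(ι_v(r)•t))_{ij}) = r · im_Q((𝕊·t)_{ij})`** (`𝕊·(c•t) = c•(𝕊·t)`, `ι_v(r)·x = r • x`, and `im_Q` is `F_v`-linear — ★ `quadraticLocalEquiv` is an
`F_v`-linear equivalence). [cite: HarrisKudlaSweet1996, §1 (1.11)] [cite: MoeglinVignerasWaldspurger1987, Chap. 2 II.1] -/
theorem im_gramS_mul_smul_apply (F : Type) [Field F] [NumberField F] (E : Type) [Field E] [NumberField E] [Algebra F E] [Algebra.IsQuadraticExtension F E]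
    (c : E ≃ₐ[F] E) {δ : E} (hcδ : c δ = -δ) (hδ : δ ≠ 0) (v : HeightOneSpectrum (𝓞 F)) {n : ℕ} (S t : Matrix (Fin n) (Fin n) (LocalRing E v))
    (r : v.adicCompletion F) (i j : Fin n) :
    im (quadraticLocalEquiv E v c hcδ hδ).toLinearEquiv.toAddEquiv ((S * (toLocalRing E v r • t)) i j) =
      r * im (quadraticLocalEquiv E v c hcδ hδ).toLinearEquiv.toAddEquiv ((S * t) i j) := by
  have hsm : toLocalRing E v r • t = r • t := by
    ext i' j'
    rw [Matrix.smul_apply, Matrix.smul_apply, smul_eq_mul, Algebra.smul_def, algebraMap_localRing_eq]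
  rw [hsm, Matrix.mul_smul, Matrix.smul_apply, im_def, im_def]
  change ((quadraticLocalEquiv E v c hcδ hδ).symm (r • (S * t) i j)).2 = r * ((quadraticLocalEquiv E v c hcδ hδ).symm ((S * t) i j)).2
  rw [map_smul, Prod.smul_snd, smul_eq_mul]

/-! ## §2 The ramified dilation row for one exp-reading -/

variable (L : Type) [Field L] [NumberField L] [IsCMField L]
variable {N M : ℕ} (e : Fin N × Fin M ≃ Fin 2)
  (dV : Fin N → L) (hdV : ∀ i, IsCMField.complexConj L (dV i) = dV i)
  (dW : Fin M → L) (hdW : ∀ i, IsCMField.complexConj L (dW i) = dW i)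
variable {M' : ℕ} (eW : Fin M × Fin 3 ≃ Fin M') (e' : Fin N × Fin M' ≃ Fin (3 + 3))
  (dV' : Fin 3 → L) (hdV' : ∀ k, IsCMField.complexConj L (dV' k) = dV' k)
  (v : HeightOneSpectrum (𝓞 (Fp L)))
  [MeasurableSpace (v.adicCompletion (Fp L))] [BorelSpace (v.adicCompletion (Fp L))]
  (μ : Measure (v.adicCompletion (Fp L))) [μ.IsAddHaarMeasure]
  (χ : HeckeCharacter L) (hχ : IsSplittingChar L 1 χ)

set_option maxHeartbeats 4000000 in -- MEASURED target: as 📤 p863057 ∕ ★ (C3) (the `MpPsi.proj _ (frameMp …)` letters)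
open scoped Classical in
/-- **THE RAMIFIED DILATION ROW FOR ONE EXP-READING** — the conclusion of ★ p862306's `hmid` binder at the reading `(Φ, P₃, κ)`: `∀ x ∈ P_Δ, F_Φ(w₁ · Ad_{d_a} x) = F_Φ(w₁ · x)`,
from the (M2a) chain letters (📤 p863057's binders, by value) and the ramified socket's unit `a` (`|ι a|_{w₀} = 1`).
[cite: Kudla1994, §3 Thm. 3.1] [cite: KudlaSweet1997, §1] [cite: HarrisKudlaSweet1996, §1 (1.11), (1.15)] [cite: MoeglinVignerasWaldspurger1987, Chap. 2 II.1] -/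

theorem flip_mul_localCongr_dA_eq_of_expReading
    (hM₂ : 0 < 3 + 3)
    (hT₀d : IsUnit (gramR L e' dV hdV (tensorFrame L dW eW dV') (tensorFrame_real L dW hdW eW dV' hdV')).det)
    {i₀ i₁ : Fin 2} (hi : i₀ ≠ i₁) {σ : Equiv.Perm (Fin (3 + 3))}
    (hσ₀ : ∀ k, σ (epsV e eW e' (i₀, k)) = finSumFinEquiv (Sum.inl k)) (hσ₁ : ∀ k, σ (epsV e eW e' (i₁, k)) = finSumFinEquiv (Sum.inr k))
    {T₁ T₂ : Matrix (Fin 3) (Fin 3) (Fp L)}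
    (P : GL (Fin (3 + 3)) (Fp L)) (hPσ : (P : Matrix (Fin (3 + 3)) (Fin (3 + 3)) (Fp L)) = σ.toPEquiv.toMatrix)
    (hP : ((P : Matrix (Fin (3 + 3)) (Fin (3 + 3)) (Fp L)))ᵀ * gramR L e' dV hdV (tensorFrame L dW eW dV') (tensorFrame_real L dW hdW eW dV' hdV') * (P : Matrix _ _ (Fp L)) = UnitaryGroup.finSum 3 3 T₁ T₂)
    (t' : Fin (3 + 3) → Fp L) (hT' : UnitaryGroup.finSum 3 3 T₁ T₂ = Matrix.diagonal t') (hT₀'d : IsUnit (UnitaryGroup.finSum 3 3 T₁ T₂).det)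
    {PD : GL (Fin ((3 + 3) + (3 + 3))) (Fp L)} (hPD : PD = UnitaryGroup.reindexGL (e₂ (3 + 3)) (UnitaryGroup.blockDiagGL (P, P)))
    (m₀ : LocalMp (Fp L) ((3 + 3) + (3 + 3)) (gramD (Fp L) (3 + 3) (gramR L e' dV hdV (tensorFrame L dW eW dV') (tensorFrame_real L dW hdW eW dV' hdV'))) v)
    (hm₀ : (deltaLagrangian (Fp L) v (3 + 3)).map (toLin (Fp L) v (MpPsi.proj _ m₀)) = lagrangianY (Fp L) ((3 + 3) + (3 + 3)) v)
    {w₁ : UnitaryGroup.localPi L (IsCMField.complexConj L) (2 + 2) (hermD L e dV hdV dW hdW) v}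
    (hw₁ : adapt (matA (Fp L) L (IsCMField.complexConj L) v 2 w₁) = Matrix.fromBlocks (1 - Matrix.single i₀ i₀ 1) (Matrix.single i₀ i₀ 1) (Matrix.single i₀ i₀ 1) (1 - Matrix.single i₀ i₀ 1))
    (hM₂' : 0 < 3) (t₁ : Fin 3 → Fp L) (hT₁t : T₁ = Matrix.diagonal t₁) (hT₁ : T₁.IsSymm) (hT₂ : T₂.IsSymm)
    (hT₁d : IsUnit T₁.det) (hT₂d : IsUnit T₂.det)
    (hTv₁ : IsUnit (localGram (Fp L) (3 + 3) (gramD (Fp L) 3 T₁) v).det)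
    (p₁ : LocalMp (Fp L) (3 + 3) (gramD (Fp L) 3 T₁) v)
    (hp₁ : (deltaLagrangian (Fp L) v 3).map (toLin (Fp L) v (MpPsi.proj _ p₁)) = lagrangianY (Fp L) (3 + 3) v)
    (B₁ : GL (Fin (3 + 3)) (v.adicCompletion (Fp L)))
    (hW₁ : MpPsi.proj _ p₁ * iotaD (Fp L) L (IsCMField.complexConj L) (complexConj_imagUnit L) (imagUnit_ne_zero L) (imagUnit_mul_self L) v 3 hT₁ rfl (weylDelta (Fp L) L (IsCMField.complexConj L) v 3 (T₀ := T₁) rfl) * (MpPsi.proj _ p₁)⁻¹ =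
      (transportSp (localGram (Fp L) (3 + 3) (gramD (Fp L) 3 T₁) v) hTv₁ (SymplecticGroup.symJ _ _))⁻¹ * transportSp (localGram (Fp L) (3 + 3) (gramD (Fp L) 3 T₁) v) hTv₁ (levi B₁))
    {mψ : ℤ} (hmψ : (adeleAddCharAt (Fp L) v).HasConductorExp mψ)
    (p₂ : LocalMp (Fp L) (3 + 3) (gramD (Fp L) 3 T₂) v)
    (hp₂ : (deltaLagrangian (Fp L) v 3).map (toLin (Fp L) v (MpPsi.proj _ p₂)) = lagrangianY (Fp L) (3 + 3) v)
    -- the non-split place and the local trace (★ `K2LiuNonsplitTracePhase.exists_localTrace`)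
    (w₀ : PlacesOver L v) (hw₀ : IsCMField.complexConj L • w₀.1 = w₀.1)
    [MeasurableSpace (w₀.1.adicCompletion L)] [BorelSpace (w₀.1.adicCompletion L)] (μK : Measure (w₀.1.adicCompletion L)) [μK.IsAddHaarMeasure]
    (τ : w₀.1.adicCompletion L →+ v.adicCompletion (Fp L)) (hτc : Continuous τ) (hτ : ∀ z, toPlace v w₀ (τ z) = z + galAdicCompletionMap (L := L) (IsCMField.complexConj L) hw₀ z)
    -- the two Cayley rows of `E′ := π(frameMp_{PD} j̃(p₁,p₂))` ((C2c)) and the Levi letters of `M_Δ` ((C3-b)), BY VALUE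
    (Bf : UnitaryGroup.localPi L (IsCMField.complexConj L) (2 + 2) (hermD L e dV hdV dW hdW) v → GL (Fin ((3 + 3) + (3 + 3))) (v.adicCompletion (Fp L)))
    (hBf : ∀ m ∈ leviDeltaLoc L e dV hdV dW hdW v, MpPsi.proj _ (frameMp (Fp L) v ((3 + 3) + (3 + 3)) PD (transpose_pd_mul_gramD_mul_pd (Fp L) (3 + 3) P hP hPD) (boxLoc (Fp L) v 3 3 (T₁ := T₁) (T₂ := T₂) (p₁, p₂))) * iotaD (Fp L) L (IsCMField.complexConj L) (complexConj_imagUnit L) (imagUnit_ne_zero L) (imagUnit_mul_self L) v (3 + 3) (gramR_isSymm L e' dV hdV (tensorFrame L dW eW dV') (tensorFrame_real L dW hdW eW dV' hdV')) (hermD_eq_map_gramD L e' dV hdV (tensorFrame L dW eW dV') (tensorFrame_real L dW hdW eW dV' hdV')) (tensorEmbLoc L e dV hdV dW hdW eW e' dV' hdV' v m) * (MpPsi.proj _ (frameMp (Fp L) v ((3 + 3) + (3 + 3)) PD (transpose_pd_mul_gramD_mul_pd (Fp L) (3 + 3) P hP hPD) (boxLoc (Fp L) v 3 3 (T₁ :=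 T₁) (T₂ := T₂) (p₁, p₂))))⁻¹ = transportSp (localGram (Fp L) ((3 + 3) + (3 + 3)) (gramD (Fp L) (3 + 3) (gramR L e' dV hdV (tensorFrame L dW eW dV') (tensorFrame_real L dW hdW eW dV' hdV'))) v) (isUnit_det_localGram_gramD (Fp L) v (3 + 3) hT₀d) (levi (Bf m)))
    -- the row exponents of the Levi rows `a_m j := (D_{m⁻¹} j i₀)(w₀)` (★ `exists_row_exponent`), BY VALUE
    (nL : UnitaryGroup.localPi L (IsCMField.complexConj L) (2 + 2) (hermD L e dV hdV dW hdW) v → ℤ)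
    (hle : ∀ m ∈ leviDeltaLoc L e dV hdV dW hdW v, ∀ j, Valued.v ((blkD (matA (Fp L) L (IsCMField.complexConj L) v 2 m⁻¹) j i₀) w₀) ≤ WithZero.exp (-1 : ℤ) ^ (-(nL m)))
    (heq : ∀ m ∈ leviDeltaLoc L e dV hdV dW hdW v, ∃ j, Valued.v ((blkD (matA (Fp L) L (IsCMField.complexConj L) v 2 m⁻¹) j i₀) w₀) = WithZero.exp (-1 : ℤ) ^ (-(nL m)))
    -- ONE lattice-pair exp-reading `(Φ, P₃, κ)` of `E′` at `w₀` of depth `k` (the binders of ★ p862306's `hmid`)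
    (Φ : SchwartzBruhat ((Fin ((3 + 3) + (3 + 3)) → v.adicCompletion (Fp L)))) (P₃ : Matrix (Fin 3) (Fin 3) (w₀.1.adicCompletion L)) (κ : (Fin ((3 + 3) + (3 + 3)) → v.adicCompletion (Fp L)) ≃+ ((Fin 2 → w₀.1.adicCompletion L) × (Fin 2 → w₀.1.adicCompletion L) × (Fin 2 → w₀.1.adicCompletion L))) (hP₃det : P₃.det = 1)
    (hK1 : ∀ (x : (Fin ((3 + 3) + (3 + 3)) → v.adicCompletion (Fp L))) (j : Fin 2), ![(κ x).1 j, (κ x).2.1 j, (κ x).2.2 j] ᵥ* P₃ = fun l => halfDiff ((eD (Fp L) L (IsCMField.complexConj L) (complexConj_imagUnit L) (imagUnit_ne_zero L) (imagUnit_mul_self L) v (3 + 3)).symm (toLin (Fp L) v (MpPsi.proj _ (frameMp (Fp L) v ((3 + 3) + (3 + 3)) PD (transpose_pd_mul_gramD_mul_pd (Fp L) (3 + 3) P hP hPD) (boxLoc (Fp L) v 3 3 (T₁ := T₁) (T₂ := T₂) (p₁, p₂))))⁻¹ (x, 0))) (epsV e eW e' (j, l)) w₀)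
    (hK2 : ∀ (x : (Fin ((3 + 3) + (3 + 3)) → v.adicCompletion (Fp L))) (j i : Fin 2), (Matrix.of fun j i => ∑ k, ∑ l, halfDiff ((eD (Fp L) L (IsCMField.complexConj L) (complexConj_imagUnit L) (imagUnit_ne_zero L) (imagUnit_mul_self L) v (3 + 3)).symm (toLin (Fp L) v (MpPsi.proj _ (frameMp (Fp L) v ((3 + 3) + (3 + 3)) PD (transpose_pd_mul_gramD_mul_pd (Fp L) (3 + 3) P hP hPD) (boxLoc (Fp L) v 3 3 (T₁ := T₁) (T₂ := T₂) (p₁, p₂))))⁻¹ (x, 0))) (epsV e eW e' (j, l)) * gramS (Fp L) L v 3 (realDiagonal L dV' hdV') k l *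
              conjLocal L (IsCMField.complexConj L) v (halfDiff ((eD (Fp L) L (IsCMField.complexConj L) (complexConj_imagUnit L) (imagUnit_ne_zero L) (imagUnit_mul_self L) v (3 + 3)).symm (toLin (Fp L) v (MpPsi.proj _ (frameMp (Fp L) v ((3 + 3) + (3 + 3)) PD (transpose_pd_mul_gramD_mul_pd (Fp L) (3 + 3) P hP hPD) (boxLoc (Fp L) v 3 3 (T₁ := T₁) (T₂ := T₂) (p₁, p₂))))⁻¹ (x, 0))) (epsV e eW e' (i, k)))) j i w₀ =
        (vecMulVec (κ x).1 (fun l => galAdicCompletionMap (L := L) (IsCMField.complexConj L) hw₀ ((κ x).2.1 l)) +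
          vecMulVec (κ x).2.1 (fun l => galAdicCompletionMap (L := L) (IsCMField.complexConj L) hw₀ ((κ x).1 l)) +
          (-(algebraMap L (w₀.1.adicCompletion L) (dV' 0) * algebraMap L (w₀.1.adicCompletion L) (dV' 1) * algebraMap L (w₀.1.adicCompletion L) (dV' 2))) • vecMulVec (κ x).2.2 (fun l => galAdicCompletionMap (L := L) (IsCMField.complexConj L) hw₀ ((κ x).2.2 l))) j i)
    (k : ℕ) (hD : Valued.v (⅟(2 : w₀.1.adicCompletion L) * (-(algebraMap L (w₀.1.adicCompletion L) (dV' 0) * algebraMap L (w₀.1.adicCompletion L) (dV' 1) * algebraMap L (w₀.1.adicCompletion L) (dV' 2)))) * WithZero.exp (-1 : ℤ) ^ (2 * (k : ℤ)) ≤ 1)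
    (hσD₀ : galAdicCompletionMap (L := L) (IsCMField.complexConj L) hw₀ (-(algebraMap L (w₀.1.adicCompletion L) (dV' 0) * algebraMap L (w₀.1.adicCompletion L) (dV' 1) * algebraMap L (w₀.1.adicCompletion L) (dV' 2))) = (-(algebraMap L (w₀.1.adicCompletion L) (dV' 0) * algebraMap L (w₀.1.adicCompletion L) (dV' 1) * algebraMap L (w₀.1.adicCompletion L) (dV' 2))))
    (hΓΦ : ((MpPsi.toOp _ (frameMp (Fp L) v ((3 + 3) + (3 + 3)) PD (transpose_pd_mul_gramD_mul_pd (Fp L) (3 + 3) P hP hPD) (boxLoc (Fp L) v 3 3 (T₁ := T₁) (T₂ := T₂) (p₁, p₂))) Φ : SchwartzBruhat ((Fin ((3 + 3) + (3 + 3)) → v.adicCompletion (Fp L)))) : (Fin ((3 + 3) + (3 + 3)) → v.adicCompletion (Fp L)) → ℂ) =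
      (κ ⁻¹' {y : ((Fin 2 → w₀.1.adicCompletion L) × (Fin 2 → w₀.1.adicCompletion L) × (Fin 2 → w₀.1.adicCompletion L)) | (∀ i, Valued.v (y.1 i) ≤ 1) ∧ (∀ i, Valued.v (y.2.1 i) ≤ 1) ∧ ∀ i, Valued.v (y.2.2 i) ≤ WithZero.exp (-1 : ℤ) ^ k}).indicator (fun _ => (1 : ℂ)) - (κ ⁻¹' {y : ((Fin 2 → w₀.1.adicCompletion L) × (Fin 2 → w₀.1.adicCompletion L) × (Fin 2 → w₀.1.adicCompletion L)) | ((∀ i, Valued.v (y.1 i) ≤ 1) ∧ (∀ i, Valued.v (y.2.1 i) ≤ 1) ∧ ∀ i, Valued.v (y.2.2 i) ≤ WithZero.exp (-1 : ℤ) ^ k) ∧ ∀ i, Valued.v (y.2.1 i) ≤ WithZero.exp (-1 : ℤ)}).indicator (fun _ => (1 : ℂ)))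
    -- the ramified socket's similitude `d_a` (★ F5′-A letters) with `a` a `w₀`-UNIT, and the `F_v`-linearity of the local trace
    (a : (Fp L)ˣ) {Dsim : GL (Fin (2 + 2)) (Fp L)}
    (hDsim : (Dsim : Matrix (Fin (2 + 2)) (Fin (2 + 2)) (Fp L)) =
      Matrix.reindex (LocalSplitting.e₂ 2) (LocalSplitting.e₂ 2) (cayR (Fp L) (Fin 2) * Matrix.fromBlocks 1 0 0 ((a : Fp L) • (1 : Matrix (Fin 2) (Fin 2) (Fp L))) * cayRinv (Fp L) (Fin 2)))
    {DA : GL (Fin (2 + 2)) L} (hDA : DA = Matrix.GeneralLinearGroup.map (algebraMap (Fp L) L) Dsim)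
    {b : L} (hb : b ≠ 0) (hDAJ : formCongr ((IsCMField.complexConj L : L ≃ₐ[Fp L] L) : L →+* L) DA (b • hermD L e dV hdV dW hdW) = hermD L e dV hdV dW hdW)
    (ha₁' : Valued.v (toPlace v w₀ ((((a⁻¹ : (Fp L)ˣ) : Fp L)) : v.adicCompletion (Fp L))) = 1)
    (hτr : ∀ (r : v.adicCompletion (Fp L)) (z : w₀.1.adicCompletion L), τ (toPlace v w₀ r * z) = r * τ z) :
    ∀ x : UnitaryGroup.localPi L (IsCMField.complexConj L) (2 + 2) (hermD L e dV hdV dW hdW) v, IsSiegelDelta (Fp L) L (IsCMField.complexConj L) (complexConj_imagUnit L) (imagUnit_ne_zero L) (imagUnit_mul_self L) v 2 (gramR_isSymm L e dV hdV dW hdW) (hermD_eq_map_gramD L e dV hdV dW hdW) x →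
      swSectionTensorLoc L e dV hdV dW hdW eW e' dV' hdV' v (localSplittingDatumCM L v μ (3 + 3) (gramR_isSymm L e' dV hdV (tensorFrame L dW eW dV') (tensorFrame_real L dW hdW eW dV' hdV')) hT₀d (hermD_eq_map_gramD L e' dV hdV (tensorFrame L dW eW dV') (tensorFrame_real L dW hdW eW dV' hdV')) χ hχ).localSplitting m₀ Φ (w₁ * localCongr L (IsCMField.complexConj L) DA hb hDAJ v x) = swSectionTensorLoc L e dV hdV dW hdW eW e' dV' hdV' v (localSplittingDatumCM L v μ (3 + 3) (gramR_isSymm L e' dV hdV (tensorFrame L dW eW dV') (tensorFrame_real L dW hdW eW dV' hdV')) hT₀d (hermD_eq_map_gramD L e' dV hdV (tensorFrame L dW eW dV') (tensorFrame_real L dW hdW eW dV' hdV')) χ hχ).localSplitting m₀ Φ (w₁ * x) := by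
  haveI hIQ : Algebra.IsQuadraticExtension (Fp L) L := IsCMField.isQuadraticExtension L
  -- the factorisation on `N_Δ · M_Δ` with `G` BY VALUE (📤 p863057)
  obtain ⟨Kc, -, hfac⟩ := exists_factorisation_of_expReading_nonsplit L e dV hdV dW hdW eW e' dV' hdV' v μ χ hχ hM₂ hT₀d hi hσ₀ hσ₁ P hPσ hP t' hT'
    hT₀'d hPD m₀ hm₀ hw₁ hM₂' t₁ hT₁t hT₁ hT₂ hT₁d hT₂d hTv₁ p₁ hp₁ B₁ hW₁ hmψ p₂ hp₂ w₀ hw₀ μK τ hτc hτ Bf hBf nL hle heq Φ P₃ κ hP₃det hK1 hK2 k hD hσD₀ hΓΦ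
  refine flip_mul_localCongr_dA_eq_of_levi_factorisation L (complexConj_imagUnit L) (imagUnit_ne_zero L) (imagUnit_mul_self L) e dV hdV dW hdW v
    (gramR_isSymm L e dV hdV dW hdW) (hermD_eq_map_gramD L e dV hdV dW hdW) a hDsim hDA hb hDAJ (fun h => swSectionTensorLoc L e dV hdV dW hdW eW e' dV' hdV' v (localSplittingDatumCM L v μ (3 + 3) (gramR_isSymm L e' dV hdV (tensorFrame L dW eW dV') (tensorFrame_real L dW hdW eW dV' hdV')) hT₀d (hermD_eq_map_gramD L e' dV hdV (tensorFrame L dW eW dV') (tensorFrame_real L dW hdW eW dV' hdV')) χ hχ).localSplitting m₀ Φ (h)) w₁ Kc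
    (fun (t : Matrix (Fin 2) (Fin 2) (LocalRing L v)) (m : UnitaryGroup.localPi L (IsCMField.complexConj L) (2 + 2) (hermD L e dV hdV dW hdW) v) =>
        (((chiDet (Fp L) L (IsCMField.complexConj L) v (3 + 3) (fun w' : PlacesOver L v => (χ.localComponent w'.1)⁻¹) (tensorEmbLoc L e dV hdV dW hdW eW e' dV' hdV' v m))⁻¹ : ℂˣ) : ℂ) * ((modSqrt (glEquiv (Bf m)) : ℂ))⁻¹ *
          ((μK.real {u : w₀.1.adicCompletion L | Valued.v u ≤ WithZero.exp (-1 : ℤ) ^ (nL m)} : ℂ) * (μK.real {u : w₀.1.adicCompletion L | Valued.v u = WithZero.exp (-1 : ℤ) ^ (nL m)} : ℂ) *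
            (μK.real {u : w₀.1.adicCompletion L | Valued.v u ≤ WithZero.exp (-1 : ℤ) ^ (nL m + k)} : ℂ) *
            (if (∀ z : w₀.1.adicCompletion L, Valued.v z ≤ WithZero.exp (-1 : ℤ) ^ (nL m) * WithZero.exp (-1 : ℤ) ^ (nL m) → ((adeleAddCharAt (Fp L) v).compAddMonoidHom ((AddMonoidHom.mulLeft (-(im (quadraticLocalEquiv L v (IsCMField.complexConj L) (complexConj_imagUnit L) (imagUnit_ne_zero L)).toLinearEquiv.toAddEquiv ((gramS (Fp L) L v 2 (gramR L e dV hdV dW hdW) * t) i₀ i₀)))).comp τ)) z = 1) then 1 else 0))) (fun m hm t ht => hfac m hm t ht) ?_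
  -- `G (a_v⁻¹ • t) m = G t m`: only the ball-triviality letter sees `t`, through `s_{a_v⁻¹•t} = a_v⁻¹ · s_t`, a `w₀`-unit rescaling
  intro m hm t ht
  have hs : (-(im (quadraticLocalEquiv L v (IsCMField.complexConj L) (complexConj_imagUnit L) (imagUnit_ne_zero L)).toLinearEquiv.toAddEquiv ((gramS (Fp L) L v 2 (gramR L e dV hdV dW hdW) * (toLocalRing L v (((a⁻¹ : (Fp L)ˣ) : Fp L) : v.adicCompletion (Fp L)) • t)) i₀ i₀))) = (-(im (quadraticLocalEquiv L v (IsCMField.complexConj L) (complexConj_imagUnit L) (imagUnit_ne_zero L)).toLinearEquiv.toAddEquiv ((gramS (Fp L) L v 2 (gramR L e dV hdV dW hdW) * t) i₀ i₀))) * ((((a⁻¹ : (Fp L)ˣ) : Fp L)) : v.adicCompletion (Fp L)) := by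
    rw [im_gramS_mul_smul_apply (Fp L) L (IsCMField.complexConj L) (complexConj_imagUnit L) (imagUnit_ne_zero L) v _ t _ i₀ i₀]
    ring
  have hiff := forall_tracePhase_mul_eq_one_iff v w₀ (adeleAddCharAt (Fp L) v) τ hτr (-(im (quadraticLocalEquiv L v (IsCMField.complexConj L) (complexConj_imagUnit L) (imagUnit_ne_zero L)).toLinearEquiv.toAddEquiv ((gramS (Fp L) L v 2 (gramR L e dV hdV dW hdW) * t) i₀ i₀))) ha₁'
    (WithZero.exp (-1 : ℤ) ^ (nL m) * WithZero.exp (-1 : ℤ) ^ (nL m))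
  simp only [hs]
  by_cases hQ : ∀ z : w₀.1.adicCompletion L, Valued.v z ≤ WithZero.exp (-1 : ℤ) ^ (nL m) * WithZero.exp (-1 : ℤ) ^ (nL m) → ((adeleAddCharAt (Fp L) v).compAddMonoidHom ((AddMonoidHom.mulLeft (-(im (quadraticLocalEquiv L v (IsCMField.complexConj L) (complexConj_imagUnit L) (imagUnit_ne_zero L)).toLinearEquiv.toAddEquiv ((gramS (Fp L) L v 2 (gramR L e dV hdV dW hdW) * t) i₀ i₀)))).comp τ)) z = 1
  · rw [if_pos (hiff.2 hQ), if_pos hQ]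
  · rw [if_neg (fun h => hQ (hiff.1 h)), if_neg hQ]

end Summit.HodgeConjecture.HodgeConjecture.Cruxes.HLiu418.K2LiuRamifiedMiddleRowOfReading

end
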